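import Summits.ResolutionOfSingularities.ResolutionOfSingularities.Theorems.NearCutArcs
import HarnessLib

/-!
# MaxContactCutNearCut — decomp-res node «NearCut» (lens-3 g22, critic row 170), tree file 10/10 of the node

Content VERBATIM from the decomp-res lens-3 g22 node `HOME/decomp-res-lens-3/g22/NearCut.lean` (pin 52e91527; HOME =
run/shared/lean/pub/decomp-res); critic row 170
BOOKED 0·0; landing orders INBOX :715 / :727 — provenance, critic text and the lens header in full in the first file
of the node, `NearCutForms`.  Namespace
`…Theorems.NearCut`; `--supports stmt-ResolutionOfSingularities-31770`; linear import chain in the lens's order.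

## This file

§N3 BOOKING — the three booked δ-balanced residual classes of `WallCut` are corollaries of `NoBalancedTailsDeep`
(binder bookkeeping through `MaxContactCutWallCut`; `section Booking`) and §N3b booking with the wall exclusion
folded in: the residual named pieces are the PORT `NearChainPort` and `BranchSelection` —
`defectWalksDeep_iff_of_nearPort` is the exact form of tree aside 31770 `DefectWalksDeep` after g22 (sections
`BookingOffWall`, `BookingChain`, `BookingBranch`).  The lens's §M `closes` (VERBATIM g15–g21 =
`MaxContactCutExponentLadder.closes`) is the ROUTE's theorem and is NOT repeated here (critic rows 158/170).

[WRITER NOTE (decomp-res writer g10): file split only (tree files ≤ 400 lines); namespace blocks, sections, section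
variables, `open` lines and every declaration
exactly as in the lens; the three deprecated `Finsupp.degree_add` occurrences read `map_add` (definitionally the same lemma).]

(Sources: cossart2020 (Cossart–Jannsen–Saito LNM 2270: Thm 5.40 p. 85, Defs 5.38/5.39 pp. 84–85, Thm 5.28 p. 72, Thm
5.35 / Cor 5.37); HauserPerlega2024 (Prop. 3 p. 791); Hauser2010Kangaroo (arXiv:0811.4151); Moh1987;
CossartPiltant2008 §2; Giraud1975; Hironaka1964.)
-/

noncomputable section

open MvPolynomial Finset
open Literature.AlgebraicGeometry.Resolution
open Literature.AlgebraicGeometry.Resolution.Hauser2010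
open Literature.AlgebraicGeometry.Resolution.PointBlowup
open Summit.ResolutionOfSingularities.ResolutionOfSingularities.Theses
open Summit.ResolutionOfSingularities.ResolutionOfSingularities.Theorems.TightDefectClasses
open Summit.ResolutionOfSingularities.ResolutionOfSingularities.Theorems.TightDefectStrongWalks
open Summit.ResolutionOfSingularities.ResolutionOfSingularities.Theorems.ItineraryCutClasses
open Summit.ResolutionOfSingularities.ResolutionOfSingularities.Theorems.BoundaryLedger
open Summit.ResolutionOfSingularities.ResolutionOfSingularities.Theorems.ProximityCut
open Summit.ResolutionOfSingularities.ResolutionOfSingularities.Theorems.ConeCutAxisLaw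
open Literature.AlgebraicGeometry.Resolution.WeightedBlowup
open Literature.Barriers.ResolutionOfSingularities
open Summit.ResolutionOfSingularities.ResolutionOfSingularities.Theorems.FloorCut
open Summit.ResolutionOfSingularities.ResolutionOfSingularities.Theorems.ConeCut
open Summit.ResolutionOfSingularities.ResolutionOfSingularities.Theorems.ExitLaw (fin3_cases eq_of_le_of_degree_le)
open Summit.ResolutionOfSingularities.ResolutionOfSingularities.Theorems.ShadeCut
open Summit.ResolutionOfSingularities.ResolutionOfSingularities.Theorems.TightCut
open Summit.ResolutionOfSingularities.ResolutionOfSingularities.Theorems.HoleCut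

namespace Summit.ResolutionOfSingularities.ResolutionOfSingularities.Theorems.NearCut

open Summit.ResolutionOfSingularities.ResolutionOfSingularities.Theorems.FreezeCut
open Summit.ResolutionOfSingularities.ResolutionOfSingularities.Theorems.WallCut

section Booking

/-! ## §N3 BOOKING — the three booked δ-balanced residual classes are corollaries of `NoBalancedTailsDeep` (binder
dropping, KERNEL), and the EXACT re-location of the host aside 31770 modulo the near-chain port. -/

/-- WILD balanced strict tails (`p ∣ s`, the g21 residual, critic window g22 (a″)) are balanced tails. [new; KERNEL]
[folklore] -/
theorem noWildBalancedStrictTails_of_noBalancedTails (h : NoBalancedTailsDeep) : NoWildBalancedStrictTailsDeep := by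
  intro p hp e he K _ _ _ _ s₀ hroot W _ N hplat hbig hrec _ s hs h3 _ _ _ _ _ hbal
  exact h p hp e he K s₀ hroot W N hplat hbig hrec s hs (by omega) hbal

/-- TAME balanced strict tails (`p ∤ s`, g21's port class) are balanced tails. [new; KERNEL] [folklore] -/
theorem noTameBalancedStrictTails_of_noBalancedTails (h : NoBalancedTailsDeep) : NoTameBalancedStrictTailsDeep := by
  intro p hp e he K _ _ _ _ s₀ hroot W _ N hplat hbig hrec _ s hs h3 _ _ _ _ _ hbal
  exact h p hp e he K s₀ hroot W N hplat hbig hrec s hs (by omega) hbal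

/-- Balanced BOUNDARY tails (`p^e + 1 = 2s`, g20's port class) are balanced tails (`δ = s − 1`). [new; KERNEL] [folklore] -/
theorem noBalancedBoundaryTails_of_noBalancedTails (h : NoBalancedTailsDeep) : NoBalancedBoundaryTailsDeep := by
  intro p hp e he K _ _ _ _ s₀ hroot W _ N hplat hbig hrec _ s hs h3 _ hline _ hbal
  refine h p hp e he K s₀ hroot W N hplat hbig hrec s hs (by omega) fun t ht => ?_
  obtain ⟨hdeg, x, hx, hy⟩ := hbal t ht
  refine ⟨by omega, x, hx, fun y hyx => ?_⟩
  have := hy y hyx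
  omega

/-- **THE WHOLE δ-BALANCED FAMILY MODULO THE PORT AND THE SHEDDING LEMMA** (companion law and directrix law PROVED in
kernel): `NearChainPort → SheddingLemma → NoBalancedTailsDeep`. [new] [folklore] -/
theorem noBalancedTails_of_port (hP : NearChainPort) (hS : SheddingLemma) : NoBalancedTailsDeep :=
  noBalancedTails_of_pieces hP companionLaw hS

/-- (a″) **THE WILD RESIDUAL DECIDED modulo the ONE printed theorem + the shedding lemma.** [new] [folklore] -/
theorem noWildBalancedStrictTails_of_port (hP : NearChainPort) (hS : SheddingLemma) :
    NoWildBalancedStrictTailsDeep :=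
  noWildBalancedStrictTails_of_noBalancedTails (noBalancedTails_of_port hP hS)

/-- … and the TAME one (g21's `BalancedWallPort` class) by the SAME port. [new] [folklore] -/
theorem noTameBalancedStrictTails_of_nearPort (hP : NearChainPort) (hS : SheddingLemma) :
    NoTameBalancedStrictTailsDeep :=
  noTameBalancedStrictTails_of_noBalancedTails (noBalancedTails_of_port hP hS)

/-- … and the BOUNDARY one (g20's `KollarWallPort` class) by the SAME port. [new] [folklore] -/
theorem noBalancedBoundaryTails_of_nearPort (hP : NearChainPort) (hS : SheddingLemma) :
    NoBalancedBoundaryTailsDeep :=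
  noBalancedBoundaryTails_of_noBalancedTails (noBalancedTails_of_port hP hS)

/-- **EXACT RE-LOCATION OF THE HOST ASIDE 31770 (`MaxContactCut.DefectWalksDeep`) modulo the near-chain port and the
shedding lemma: the residual of the skew joint axis is `FREE-POINT ∧ HIGH-PLANAR ∧ LOSSY`** — every δ-balanced
class (boundary, tame, wild) discharged by ONE printed theorem (CJS 5.40) read through the PROVED companion /
directrix laws. [new] [folklore] -/
theorem defectWalksDeep_iff_of_nearPort (hP : NearChainPort) (hS : SheddingLemma) :
    MaxContactCut.DefectWalksDeep ↔
      NoFreePointTailsDeep ∧ NoHighPlanarJointTailsDeep ∧ NoLossyStrictTailsDeep :=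
  defectWalksDeep_iff_highPlanar_boundary_lossy_tame_wild.trans
    ⟨fun h => ⟨h.1, h.2.1, h.2.2.2.1⟩, fun h =>
      ⟨h.1, h.2.1, noBalancedBoundaryTails_of_nearPort hP hS, h.2.2, noTameBalancedStrictTails_of_nearPort hP hS,
        noWildBalancedStrictTails_of_port hP hS⟩⟩

/-- READING R1 (keep g21's `BalancedWallPort` for the tame/boundary classes, use the near-chain port for the wild class
only): the host residual is again `FREE-POINT ∧ HIGH-PLANAR ∧ LOSSY`. [new] [folklore] -/
theorem defectWalksDeep_iff_of_both_ports (hπ : BalancedWallPort) (hP : NearChainPort) (hS : SheddingLemma) :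
    MaxContactCut.DefectWalksDeep ↔
      NoFreePointTailsDeep ∧ NoHighPlanarJointTailsDeep ∧ NoLossyStrictTailsDeep :=
  (defectWalksDeep_iff_of_port hπ).trans
    ⟨fun h => ⟨h.1, h.2.1, h.2.2.1⟩, fun h => ⟨h.1, h.2.1, h.2.2, noWildBalancedStrictTails_of_port hP hS⟩⟩

/-- The balanced-tail class is NECESSARY as well: it follows from the host (every balanced tail has positive shades …
no: the host quantifies over walks with all shades `≥ 1`; a balanced tail need not — so we record the implication from
the host's STRONG form only for the three booked sub-classes, which carry that binder). [new; KERNEL] [folklore] -/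
theorem wild_tame_boundary_of_defectWalksDeep (h : MaxContactCut.DefectWalksDeep) :
    NoWildBalancedStrictTailsDeep ∧ NoTameBalancedStrictTailsDeep ∧ NoBalancedBoundaryTailsDeep :=
  ⟨wildBalanced_of_defectWalksDeep h, tameBalanced_of_defectWalksDeep h,
    (defectWalksDeep_iff_highPlanar_boundary_lossy_tame_wild.mp h).2.2.1⟩

end Booking

section BookingOffWall

/-! ### §N3b Booking with the wall exclusion folded in: the residual named pieces are the PORT (`NearChainPort` =
CJS Thm 5.40) and the OFF-WALL SHEDDING target only. -/

/-- The whole δ-balanced family modulo the port and the off-wall shedding target. [new; composition] [folklore] -/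
theorem noBalancedTails_of_port_offWall (hP : NearChainPort) (hO : OffWallShedding) : NoBalancedTailsDeep :=
  noBalancedTails_of_port hP (sheddingLemma_of_offWall hO)

/-- The WILD balanced strict class (this generation's target) modulo the port and the off-wall shedding target.
[new] [folklore] -/
theorem noWildBalancedStrictTails_of_port_offWall (hP : NearChainPort) (hO : OffWallShedding) :
    NoWildBalancedStrictTailsDeep :=
  noWildBalancedStrictTails_of_noBalancedTails (noBalancedTails_of_port_offWall hP hO)

/-- The TAME balanced strict class likewise (second, Tschirnhaus-free decision of g21's ported class). [new] [folklore] -/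
theorem noTameBalancedStrictTails_of_port_offWall (hP : NearChainPort) (hO : OffWallShedding) :
    NoTameBalancedStrictTailsDeep :=
  noTameBalancedStrictTails_of_noBalancedTails (noBalancedTails_of_port_offWall hP hO)

/-- The balanced BOUNDARY class likewise. [new] [folklore] -/
theorem noBalancedBoundaryTails_of_port_offWall (hP : NearChainPort) (hO : OffWallShedding) :
    NoBalancedBoundaryTailsDeep :=
  noBalancedBoundaryTails_of_noBalancedTails (noBalancedTails_of_port_offWall hP hO)

/-- **EXACT RE-LOCATION OF THE HOST ASIDE 31770 (reading R2′):** modulo the ONE printed theorem `NearChainPort` and the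
classical off-wall shedding target, `DefectWalksDeep` is equivalent to the three remaining classes (free point, high
planar joint, lossy strict). [new; composition] [folklore] -/
theorem defectWalksDeep_iff_of_nearPort_offWall (hP : NearChainPort) (hO : OffWallShedding) :
    MaxContactCut.DefectWalksDeep ↔
      NoFreePointTailsDeep ∧ NoHighPlanarJointTailsDeep ∧ NoLossyStrictTailsDeep :=
  defectWalksDeep_iff_of_nearPort hP (sheddingLemma_of_offWall hO)

end BookingOffWall

section BookingChain

/-- The whole δ-balanced family modulo the port and the WALK-FREE shedding target `ChainShedding`. [new;
composition] [folklore] -/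
theorem noBalancedTails_of_port_chain (hP : NearChainPort) (hC : ChainShedding) : NoBalancedTailsDeep :=
  noBalancedTails_of_port hP (sheddingLemma_of_chainShedding hC)

/-- The WILD balanced strict class modulo the port and `ChainShedding`. [new] [folklore] -/
theorem noWildBalancedStrictTails_of_port_chain (hP : NearChainPort) (hC : ChainShedding) :
    NoWildBalancedStrictTailsDeep :=
  noWildBalancedStrictTails_of_noBalancedTails (noBalancedTails_of_port_chain hP hC)

/-- **EXACT RE-LOCATION OF THE HOST ASIDE 31770 (reading R2″, final form of g22):** modulo the ONE printed theorem
`NearChainPort` (CJS Thm 5.40) and the walk-free classical target `ChainShedding`. [new; composition] [folklore] -/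
theorem defectWalksDeep_iff_of_nearPort_chain (hP : NearChainPort) (hC : ChainShedding) :
    MaxContactCut.DefectWalksDeep ↔
      NoFreePointTailsDeep ∧ NoHighPlanarJointTailsDeep ∧ NoLossyStrictTailsDeep :=
  defectWalksDeep_iff_of_nearPort hP (sheddingLemma_of_chainShedding hC)

end BookingChain

section BookingBranch

/-- The whole δ-balanced family modulo the port and the LIBRARY target `BranchSelection` (the monovariant is kernel:
`arc_shedding`). [new; composition] [folklore] -/
theorem noBalancedTails_of_port_branch (hP : NearChainPort) (hB : BranchSelection) : NoBalancedTailsDeep :=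
  noBalancedTails_of_port_chain hP (chainShedding_of_branchSelection hB)

/-- The WILD balanced strict class modulo the port and `BranchSelection`. [new] [folklore] -/
theorem noWildBalancedStrictTails_of_port_branch (hP : NearChainPort) (hB : BranchSelection) :
    NoWildBalancedStrictTailsDeep :=
  noWildBalancedStrictTails_of_noBalancedTails (noBalancedTails_of_port_branch hP hB)

/-- **EXACT RE-LOCATION OF THE HOST ASIDE 31770 (reading R2‴, final form of g22):** modulo the ONE printed theorem
`NearChainPort` (CJS Thm 5.40) and the library fact `BranchSelection` (curve selection / arc lifting along the chain);
the problem-specific shedding argument is kernel (`arc_shedding`, `walls_succ`, `wallIsolation`). [new; composition]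
[folklore] -/
theorem defectWalksDeep_iff_of_nearPort_branch (hP : NearChainPort) (hB : BranchSelection) :
    MaxContactCut.DefectWalksDeep ↔
      NoFreePointTailsDeep ∧ NoHighPlanarJointTailsDeep ∧ NoLossyStrictTailsDeep :=
  defectWalksDeep_iff_of_nearPort_chain hP (chainShedding_of_branchSelection hB)

end BookingBranch

end Summit.ResolutionOfSingularities.ResolutionOfSingularities.Theorems.NearCut
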